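import Literature.Topology.FourManifolds.SeifertAlgebraicModelsAssembly
import Literature.Topology.FourManifolds.JordanBrouwerClosedHypersurface
import HarnessLib

/-!
# Seifert's theorem: discharge of `Seifert1936_algebraicModel`

Topic `Literature/Topology/FourManifolds` (last rung of the proof of the named fact
`Literature.Topology.FourManifolds.Seifert1936_algebraicModel`, `SeifertAlgebraicModels.lean`).
**Everything in this file is proved; no named fact is introduced.**

H. Seifert, *Algebraische Approximation von Mannigfaltigkeiten*, Math. Z. 41 (1936) 1–17, in the
form recorded and reproved by S. Akbulut, H. King, *Topology of Real Algebraic Sets* (1992),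
Ch. II, Thm. 2.8.2 with `V = ℝⁿ` and §10 ¶1: every compact smooth hypersurface of `ℝᵐ⁺¹` is
isotopic, through smooth embeddings, to the nonsingular zero set of one polynomial.  The printed
proof is formalised across the sibling files:

* `SeifertAlgebraicModelsWeierstrass.lean` — Lemma 2.8.1 (a) for `V = ℝⁿ`: `C¹` Weierstrass
  approximation on compacts;
* `SeifertAlgebraicModelsGrowth.lean` — the correction `λ = p + (r²/3b)ᵐ` (last paragraph of
  the proof of Thm. 2.8.2);
* `SeifertAlgebraicModelsLevelPrelim.lean`, `SeifertAlgebraicModelsLevelIsotopy.lean` — "by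
  transversality, the zeroes of `λ` are a manifold isotopic to `M`" (level-set isotopy by the
  flow of `-(g₁ - g) ∇g_t/‖∇g_t‖²`);
* `SeifertAlgebraicModelsReduction.lean` — the theorem from a global defining function;
* `SeifertAlgebraicModelsLocalSlice.lean`, `SeifertAlgebraicModelsSides.lean`,
  `SeifertAlgebraicModelsDefiningFunction.lean`, `SeifertAlgebraicModelsAssembly.lean` —
  Assertion 2.8.2.1 with `W = ∅` (local generators, the two sides, partition of unity,
  components, dimension `0`), given separation;
* `JordanBrouwerClosedHypersurface.lean` — the separation theorem (Alexander duality over `ℤ/2`).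

* `Literature.Topology.FourManifolds.not_isPreconnected_compl_range_of_isSmoothEmbedding` — a
  compact connected smoothly embedded `m`-manifold (`m ≥ 1`) separates `ℝᵐ⁺¹`;
* `Literature.Topology.FourManifolds.Seifert1936_algebraicModel_holds` — **the discharge**.

## References

* H. Seifert, *Algebraische Approximation von Mannigfaltigkeiten*, Math. Z. 41 (1936) 1–17.
  [Seifert1936]
* S. Akbulut, H. King, *Topology of Real Algebraic Sets*, MSRI Publ. 25, Springer (1992), Ch. II,
  Lemma 2.8.1, Thm. 2.8.2 (PDF pp. 68–72), §10 ¶1 (PDF p. 93). [AkbulutKing1992]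
-/

open scoped Manifold ContDiff
open Function Set Manifold

noncomputable section

namespace Literature.Topology.FourManifolds

universe u

/-- **A compact connected smooth hypersurface separates Euclidean space**: for a smooth embedding
`e : M → ℝᵐ⁺¹` (`m ≥ 1`) of a compact connected manifold, `ℝᵐ⁺¹ ∖ e(M)` is not connected
(the topological Jordan–Brouwer theorem `not_isPreconnected_compl_of_homeomorph_closedManifold`
applied to `M ≅ e(M)`). [cite: HatcherAT2002, §3.3 Prop. 3.46 (Alexander duality)] -/
theorem not_isPreconnected_compl_range_of_isSmoothEmbedding {m : ℕ} (hm : 1 ≤ m) {M : Type u}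
    [TopologicalSpace M] [CompactSpace M] [ConnectedSpace M]
    [ChartedSpace (EuclideanSpace ℝ (Fin m)) M] [IsManifold (𝓡 m) ∞ M]
    {e : M → EuclideanSpace ℝ (Fin (m + 1))} (he : IsSmoothEmbedding (𝓡 m) (𝓡 (m + 1)) ∞ e) :
    ¬ IsPreconnected (range e)ᶜ := by
  haveI : T2Space M := he.isEmbedding.t2Space
  exact not_isPreconnected_compl_of_homeomorph_closedManifold rfl hm
    (isCompact_range he.contMDiff.continuous) he.isEmbedding.toHomeomorph

/-- **Seifert's theorem** (1936; Akbulut–King 1992, Thm. 2.8.2 for `V = ℝⁿ`, §10 ¶1): discharge of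
the named fact `Literature.Topology.FourManifolds.Seifert1936_algebraicModel` — every compact
smooth hypersurface `e : M ↪ ℝᵐ⁺¹` is smoothly isotopic, through smooth embeddings, to an
embedding whose image is the whole zero set of one polynomial, nonsingular along it.
[cite: AkbulutKing1992, Thm. 2.8.2 (V = ℝⁿ) and Ch. II §10 ¶1] [cite: Seifert1936] -/
theorem Seifert1936_algebraicModel_holds : Seifert1936_algebraicModel.{u} :=
  Seifert1936_algebraicModel_of_separation fun _ hm _ _ _ _ _ _ _ he =>
    not_isPreconnected_compl_range_of_isSmoothEmbedding hm he

end Literature.Topology.FourManifolds
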